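import Literature.NumberTheory.ComplexMultiplication.CMTypeGaloisClassReflexDegree
import Literature.NumberTheory.ComplexMultiplication.EquivalentCMTypesReflexField
import HarnessLib

/-!
# The reflex field of a Galois translate is the conjugate reflex field: `ℚ(tr_{τΦ}) = τ(ℚ(tr_Φ))`
# (Shimura 1998 §8.3 Prop. 28; Milne 2007 §1.1); abelian `K`: simple CM points are isogenous iff their types are
# Galois equivalent

Layer `Literature/NumberTheory/ComplexMultiplication`, namespace `Literature.NumberTheory.ComplexMultiplication` (lane
`lit-hodgefound`, Track 2 foundations, Layer A3; seat `lit-hodgefound-p11`, generation 24, row g24-#7).  Sequel of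
`CMTypeGaloisEquivalence` (g24-#5: `cmTypeGaloisSetoid K`, `Ψ = τΦ`, `τ ∈ Aut(ℂ)`; abelian `K`: `= cmTypeEquivSetoid K`),
`CMTypeGaloisClassReflexDegree` (g24-#6: `#{τΦ} = [K* : ℚ]`) and the tree's `EquivalentCMTypesReflexField`
(`traceField_twist`: `ℚ(tr_{Φσ}) = ℚ(tr_Φ)`) on the complex reflex field `traceField Φ = ℚ(tr_Φ(K)) ⊂ ℂ`.
THEOREMS ONLY; no definition, no named fact (D-0026).

THE PRINT.  G. Shimura, *Abelian Varieties with Complex Multiplication and Modular Functions* (1998), §8.3 Prop. 28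
«`K* = ℚ(∑ᵢ ξ^{φᵢ} | ξ ∈ F)`»; J. S. Milne, *The fundamental theorem of complex multiplication* (arXiv:0705.3446),
§1.1 (held text p0003 L23–L28): «let `Tr_Φ(a) = ∑_{φ ∈ Φ} φ(a) ∈ ℂ`.  The reflex field `E*` of `(E, Φ)` is the
subfield of `ℂ` generated by the elements `Tr_Φ(a)`, `a ∈ E`.  It can also be described as the fixed field of
`{σ ∈ Gal(ℚ^al/ℚ) | σΦ = Φ}`.»  For the translate `τΦ = {τ ∘ φ}` (DIS 2022 Def. 8) the generators are
`Tr_{τΦ}(a) = ∑ τ(φ(a)) = τ(Tr_Φ(a))`, so `E*(τΦ) = τ(E*(Φ))` — the fixed field of the conjugate stabiliser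
`τ · Stab(Φ) · τ⁻¹`.

WHAT IS PROVED (`K` a CM field, `Φ : CMType K`, `τ ∈ Aut(ℂ)`).
* **`cmTypeTrace_cmTypeSmul` (`tr_{τΦ}(x) = τ(tr_Φ(x))`)**, `range_cmTypeTrace_cmTypeSmul`,
  **`traceField_cmTypeSmul` : `ℚ(tr_{τΦ}) = τ(ℚ(tr_Φ))`** (`IntermediateField.map`); hence Galois-equivalent types
  have ISOMORPHIC reflex fields (`nonempty_algEquiv_traceField_of_rel`) of the SAME degree
  (`finrank_traceField_cmTypeSmul`, `finrank_traceField_eq_of_rel`; cf. g24-#6: that degree is the size of the class).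
* **`traceField_cmTypeSmul_eq_of_forall_fieldRange_eq`**: if `K* = ℚ(tr_Φ)` is normal over `ℚ` (all its conjugates in
  `ℂ` coincide), every translate has the SAME reflex field `⊂ ℂ` (converse direction `map_traceField_eq_of_forall_…`); `traceField_cmTypeSmul_eq_iff` (`ℚ(tr_{τΦ}) = ℚ(tr_Φ) ↔ τ(K*) = K*`); `cmTypeSmul_cmTypeSmul_eq_iff`
  (the stabiliser of `τΦ` is the conjugate of that of `Φ`).
* `K/ℚ` ABELIAN (g24-#5: Galois classes = Streng classes, and `ℚ(tr_{Φσ}) = ℚ(tr_Φ)`):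
  **`traceField_eq_of_rel_of_comm`** — all types Galois equivalent to `Φ` have the reflex field of `Φ`;
  `traceField_cmTypeSmul_eq_of_comm`, `map_traceField_eq_of_comm` (`τ(K*) = K*`).
* Siegel side (g23-#2 / g24-#3 vocabulary `SiegelCMPoint.IsCMPointOf`, `prinPeriod`): for `K/ℚ` ABELIAN of degree
  `2n`, CM points `Z, Z′ ∈ 𝔥_n` of `K` with `X_{Z′}` simple: **`X_Z ∼ X_{Z′} ⟺` the types are Galois equivalent**
  (`SiegelCMPoint.IsCMPointOf.isIsogenous_iff_cmTypeGaloisSetoid_r`, `…_of_isCyclic`; Streng Lemma I.5.6 + g24-#5),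
  and then they have the same reflex field (`traceField_cmType_eq_of_isIsogenous`).

## References

* [Shimura1998] G. Shimura, *Abelian Varieties with Complex Multiplication and Modular Functions* (1998), §8.3 Prop. 28,
  §8.4 Example (1).
* [Milne2007FundamentalCM] J. S. Milne, *The fundamental theorem of complex multiplication*, arXiv:0705.3446, §1.1.
* [DinaIonicaSijsling2022] B. Dina, S. Ionica, J. Sijsling, Math. Comp. 91 (2022), §1.2 Def. 8, Prop. 10.
* [Streng2010] M. Streng, *Complex multiplication of abelian surfaces* (2010), Ch. I §4 p. 22, Lemma 5.6 p. 26.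

## Provenance

Lane `lit-hodgefound` (HOME `run/shared/lean/pub/lit-hodgefound/`), prover seat `lit-hodgefound-p11` (gen 24),
self-proposed row g24-#7 (INBOX claim 2026-08-27, l.40019).
-/

set_option autoImplicit false

noncomputable section

open scoped Classical NumberField Pointwise
open NumberField Module IntermediateField

namespace Literature.NumberTheory.ComplexMultiplication

open Literature.AlgebraicGeometry.Motives (CMType)
open Literature.AlgebraicGeometry.Motives.HodgeStructure (cmTypeSmul cmTypeSmul_val)

variable {K : Type} [Field K] [NumberField K] [IsCMField K]

/-! ## §1 `tr_{τΦ} = τ ∘ tr_Φ` and `ℚ(tr_{τΦ}) = τ(ℚ(tr_Φ))` -/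

section Translate

/-- **`tr_{τΦ}(x) = τ(tr_Φ(x))`**: `∑_{ψ ∈ τΦ} ψ(x) = ∑_{φ ∈ Φ} τ(φ(x))`. [cite: Shimura1998, §8.3 Prop. 28]
[cite: Milne2007FundamentalCM, §1.1] -/
theorem cmTypeTrace_cmTypeSmul (τ : ℂ ≃+* ℂ) (Φ : CMType K) (x : K) :
    cmTypeTrace (cmTypeSmul τ Φ) x = τ (cmTypeTrace Φ x) := by
  rw [apply_cmTypeTrace, cmTypeTrace_apply]
  refine Finset.sum_equiv (Equiv.mk (fun ψ : K →+* ℂ => τ⁻¹ • ψ) (fun φ : K →+* ℂ => τ • φ)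
    (fun ψ => smul_inv_smul τ ψ) (fun φ => inv_smul_smul τ φ)) (fun ψ => ?_) (fun ψ _ => ?_)
  · rw [Set.Finite.mem_toFinset, Set.Finite.mem_toFinset, Equiv.coe_fn_mk, mem_cmTypeSmul_iff]
  · rw [Equiv.coe_fn_mk, smul_inv_smul]

/-- The values of `tr_{τΦ}` are the `τ`-images of the values of `tr_Φ`. [cite: Shimura1998, §8.3 Prop. 28]
[cite: Milne2007FundamentalCM, §1.1] -/
theorem range_cmTypeTrace_cmTypeSmul (τ : ℂ ≃+* ℂ) (Φ : CMType K) :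
    Set.range (cmTypeTrace (cmTypeSmul τ Φ)) = τ '' Set.range (cmTypeTrace Φ) := by
  ext z
  simp only [Set.mem_range, Set.mem_image, cmTypeTrace_cmTypeSmul]
  constructor
  · rintro ⟨x, rfl⟩
    exact ⟨_, ⟨x, rfl⟩, rfl⟩
  · rintro ⟨_, ⟨x, rfl⟩, rfl⟩
    exact ⟨x, rfl⟩

/-- **THE REFLEX FIELD OF THE TRANSLATE IS THE CONJUGATE FIELD: `ℚ(tr_{τΦ}(K)) = τ(ℚ(tr_Φ(K)))`** («the subfield of
`ℂ` generated by the elements `Tr_Φ(a)`», and `Tr_{τΦ} = τ ∘ Tr_Φ`). [cite: Shimura1998, §8.3 Prop. 28]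
[cite: Milne2007FundamentalCM, §1.1] -/
theorem traceField_cmTypeSmul (τ : ℂ ≃+* ℂ) (Φ : CMType K) :
    traceField (cmTypeSmul τ Φ) = (traceField Φ).map (τ : ℂ →+* ℂ).toRatAlgHom := by
  rw [traceField, traceField, range_cmTypeTrace_cmTypeSmul, IntermediateField.adjoin_map]
  rfl

/-- `ℚ(tr_{τΦ}) ≅ ℚ(tr_Φ)` as fields. [cite: Shimura1998, §8.3 Prop. 28] [cite: Milne2007FundamentalCM, §1.1] -/
theorem nonempty_algEquiv_traceField_cmTypeSmul (τ : ℂ ≃+* ℂ) (Φ : CMType K) :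
    Nonempty (traceField Φ ≃ₐ[ℚ] traceField (cmTypeSmul τ Φ)) := by
  rw [traceField_cmTypeSmul]
  exact ⟨IntermediateField.equivMap _ _⟩

/-- **Galois translates have reflex fields of the same degree** (each equal to the size of the common Galois class,
g24-#6). [cite: Shimura1998, §8.3 Prop. 28] [cite: DinaIonicaSijsling2022, §1.2 Def. 8] -/
theorem finrank_traceField_cmTypeSmul (τ : ℂ ≃+* ℂ) (Φ : CMType K) :
    finrank ℚ (traceField (cmTypeSmul τ Φ)) = finrank ℚ (traceField Φ) := by
  rw [traceField_cmTypeSmul]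
  exact (IntermediateField.equivMap (traceField Φ) _).toLinearEquiv.finrank_eq.symm

/-- Galois-equivalent types have isomorphic reflex fields … [cite: DinaIonicaSijsling2022, §1.2 Def. 8]
[cite: Milne2007FundamentalCM, §1.1] -/
theorem nonempty_algEquiv_traceField_of_rel {Φ Ψ : CMType K} (h : (cmTypeGaloisSetoid K).r Φ Ψ) :
    Nonempty (traceField Φ ≃ₐ[ℚ] traceField Ψ) := by
  obtain ⟨τ, rfl⟩ := h
  exact nonempty_algEquiv_traceField_cmTypeSmul τ Φ

/-- … of the same degree. [cite: DinaIonicaSijsling2022, §1.2 Def. 8] [cite: Milne2007FundamentalCM, §1.1] -/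
theorem finrank_traceField_eq_of_rel {Φ Ψ : CMType K} (h : (cmTypeGaloisSetoid K).r Φ Ψ) :
    finrank ℚ (traceField Ψ) = finrank ℚ (traceField Φ) := by
  obtain ⟨τ, rfl⟩ := h
  exact finrank_traceField_cmTypeSmul τ Φ

/-- `ℚ(tr_{τΦ}) = ℚ(tr_Φ) ↔ τ(K*) = K*`. [cite: Shimura1998, §8.3 Prop. 28] [cite: Milne2007FundamentalCM, §1.1] -/
theorem traceField_cmTypeSmul_eq_iff (τ : ℂ ≃+* ℂ) (Φ : CMType K) :
    traceField (cmTypeSmul τ Φ) = traceField Φ ↔ (traceField Φ).map (τ : ℂ →+* ℂ).toRatAlgHom = traceField Φ := by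
  rw [traceField_cmTypeSmul]

/-- **`K*` NORMAL over `ℚ` ⟹ all Galois translates of `Φ` have the same reflex field `K* ⊂ ℂ`.**  Normality is
taken in the concrete form «all conjugates of `K*` inside `ℂ` coincide» (`∀ f : K* →ₐ[ℚ] ℂ, f(K*) = K*`, which is
Mathlib's `AlgHom.fieldRange_of_normal` for a `Normal ℚ K*` instance on the intermediate field; stated this way to
avoid the two `ℚ`-algebra structures on a subfield of `ℂ`). [cite: Milne2007FundamentalCM, §1.1] [cite: Shimura1998, §8.3 Prop. 28] -/
theorem traceField_cmTypeSmul_eq_of_forall_fieldRange_eq (Φ : CMType K)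
    (hn : ∀ f : traceField Φ →ₐ[ℚ] ℂ, f.fieldRange = traceField Φ) (τ : ℂ ≃+* ℂ) :
    traceField (cmTypeSmul τ Φ) = traceField Φ := by
  have hmap : (traceField Φ).map (τ : ℂ →+* ℂ).toRatAlgHom =
      ((τ : ℂ →+* ℂ).toRatAlgHom.comp (traceField Φ).val).fieldRange := by
    ext z
    simp only [IntermediateField.mem_map, AlgHom.mem_fieldRange, AlgHom.coe_comp, Function.comp_apply,
      IntermediateField.coe_val]
    constructor
    · rintro ⟨x, hx, rfl⟩
      exact ⟨⟨x, hx⟩, rfl⟩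
    · rintro ⟨x, rfl⟩
      exact ⟨x, x.2, rfl⟩
  rw [traceField_cmTypeSmul, hmap]
  exact hn _

/-- Conversely, if all translates have the reflex field of `Φ`, then every automorphism of `ℂ` maps `K*` onto itself.
[cite: Milne2007FundamentalCM, §1.1] [cite: Shimura1998, §8.3 Prop. 28] -/
theorem map_traceField_eq_of_forall_traceField_cmTypeSmul_eq (Φ : CMType K)
    (h : ∀ τ : ℂ ≃+* ℂ, traceField (cmTypeSmul τ Φ) = traceField Φ) (τ : ℂ ≃+* ℂ) :
    (traceField Φ).map (τ : ℂ →+* ℂ).toRatAlgHom = traceField Φ := by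
  rw [← traceField_cmTypeSmul, h]

/-- The stabiliser of `τΦ` is the conjugate of that of `Φ`: `τ′(τΦ) = τΦ ↔ (τ⁻¹τ′τ)Φ = Φ` (both: «fixes the reflex
field pointwise», for `τ(K*)` resp. `K*`). [cite: Milne2007FundamentalCM, §1.1] [cite: Shimura1998, §8.3 Prop. 28] -/
theorem cmTypeSmul_cmTypeSmul_eq_iff (τ τ' : ℂ ≃+* ℂ) (Φ : CMType K) :
    cmTypeSmul τ' (cmTypeSmul τ Φ) = cmTypeSmul τ Φ ↔ cmTypeSmul (τ⁻¹ * τ' * τ) Φ = Φ := by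
  constructor
  · intro h
    rw [cmTypeSmul_mul, cmTypeSmul_mul, h, cmTypeSmul_inv_cmTypeSmul]
  · intro h
    have h2 := congrArg (cmTypeSmul τ) h
    rwa [← cmTypeSmul_mul, ← mul_assoc, ← mul_assoc, mul_inv_cancel, one_mul, cmTypeSmul_mul] at h2

end Translate

/-! ## §2 `K/ℚ` abelian: one reflex field per class -/

section Abelian

/-- **`K/ℚ` ABELIAN: Galois-equivalent types have THE SAME reflex field `⊂ ℂ`** (Galois classes are Streng classes,
g24-#5, and `ℚ(tr_{Φσ}) = ℚ(tr_Φ)`, `traceField_twist`). [cite: DinaIonicaSijsling2022, §1.2 Prop. 10]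
[cite: Shimura1998, §8.3 Prop. 28 and §8.4 Example (1)] -/
theorem traceField_eq_of_rel_of_comm [IsGalois ℚ K] (hcomm : ∀ a b : K ≃ₐ[ℚ] K, a * b = b * a) {Φ Ψ : CMType K}
    (h : (cmTypeGaloisSetoid K).r Φ Ψ) : traceField Ψ = traceField Φ := by
  rw [cmTypeGaloisSetoid_eq_cmTypeEquivSetoid hcomm] at h
  obtain ⟨σ, rfl⟩ := h
  exact traceField_twist σ Φ

/-- `K/ℚ` abelian: `ℚ(tr_{τΦ}) = ℚ(tr_Φ)` for every `τ ∈ Aut(ℂ)`. [cite: DinaIonicaSijsling2022, §1.2 Prop. 10]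
[cite: Shimura1998, §8.3 Prop. 28 and §8.4 Example (1)] -/
theorem traceField_cmTypeSmul_eq_of_comm [IsGalois ℚ K] (hcomm : ∀ a b : K ≃ₐ[ℚ] K, a * b = b * a) (τ : ℂ ≃+* ℂ)
    (Φ : CMType K) : traceField (cmTypeSmul τ Φ) = traceField Φ :=
  traceField_eq_of_rel_of_comm hcomm ⟨τ, rfl⟩

/-- `K/ℚ` abelian: `τ(K*) = K*` for every `τ ∈ Aut(ℂ)` (`K* ⊆ φ(K)` is abelian over `ℚ`). [cite: Shimura1998, §8.4 Example (1)] -/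
theorem map_traceField_eq_of_comm [IsGalois ℚ K] (hcomm : ∀ a b : K ≃ₐ[ℚ] K, a * b = b * a) (τ : ℂ ≃+* ℂ)
    (Φ : CMType K) : (traceField Φ).map (τ : ℂ →+* ℂ).toRatAlgHom = traceField Φ := by
  rw [← traceField_cmTypeSmul, traceField_cmTypeSmul_eq_of_comm hcomm]

end Abelian

/-! ## §3 Siegel CM points of an abelian CM field: isogenous iff Galois-equivalent types -/

section Siegel

open Literature.NumberTheory.Automorphic (siegelUpperHalfSpace)
open Literature.AlgebraicGeometry.ModuliOfAbelianVarieties.SiegelModuli (prinPeriod)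
open Literature.Geometry.Kaehler.ComplexTorus (IsIsogenous IsSimple)

variable {g : ℕ} {Z Z' : siegelUpperHalfSpace g} {h h' : K →ₐ[ℚ] Matrix (Fin g ⊕ Fin g) (Fin g ⊕ Fin g) ℚ}

/-- **`K/ℚ` ABELIAN of degree `2n`, `Z, Z′ ∈ 𝔥_n` CM points of `K` with `X_{Z′}` simple: `X_Z ∼ X_{Z′} ⟺` the types
`Φ_Z`, `Φ_{Z′}` are GALOIS EQUIVALENT** (Streng Lemma I.5.6 «`Φ = Φ′σ`» on `𝔥_n`, the tree's
`IsCMPointOf.isIsogenous_iff_exists_cmType_eq_twist`, with g24-#5 `cmTypeGaloisSetoid = cmTypeEquivSetoid`).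
[cite: Streng2010, Ch. I Lemma 5.6, p. 26] [cite: DinaIonicaSijsling2022, §1.2 Def. 8 and Prop. 10] -/
theorem SiegelCMPoint.IsCMPointOf.isIsogenous_iff_cmTypeGaloisSetoid_r [IsGalois ℚ K]
    (hcomm : ∀ a b : K ≃ₐ[ℚ] K, a * b = b * a) (hK : finrank ℚ K = 2 * g) (hZ : SiegelCMPoint.IsCMPointOf h Z)
    (hZ' : SiegelCMPoint.IsCMPointOf h' Z') (hS : IsSimple (prinPeriod Z')) :
    IsIsogenous (prinPeriod Z) (prinPeriod Z') ↔ (cmTypeGaloisSetoid K).r (hZ'.cmType hK) (hZ.cmType hK) := by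
  rw [hZ.isIsogenous_iff_exists_cmType_eq_twist hK hZ' hS, cmTypeGaloisSetoid_eq_cmTypeEquivSetoid hcomm]
  rfl

/-- The same with `X_Z` simple. [cite: Streng2010, Ch. I Lemma 5.6, p. 26] [cite: DinaIonicaSijsling2022, §1.2 Def. 8 and Prop. 10] -/
theorem SiegelCMPoint.IsCMPointOf.isIsogenous_iff_cmTypeGaloisSetoid_r' [IsGalois ℚ K]
    (hcomm : ∀ a b : K ≃ₐ[ℚ] K, a * b = b * a) (hK : finrank ℚ K = 2 * g) (hZ : SiegelCMPoint.IsCMPointOf h Z)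
    (hZ' : SiegelCMPoint.IsCMPointOf h' Z') (hS : IsSimple (prinPeriod Z)) :
    IsIsogenous (prinPeriod Z) (prinPeriod Z') ↔ (cmTypeGaloisSetoid K).r (hZ'.cmType hK) (hZ.cmType hK) := by
  rw [hZ.isIsogenous_iff_exists_cmType_eq_twist' hK hZ' hS, cmTypeGaloisSetoid_eq_cmTypeEquivSetoid hcomm]
  rfl

/-- Cyclic Galois group (e.g. `ℚ(ζ_p)`, cyclic sextic / quartic CM fields): the same criterion.
[cite: Streng2010, Ch. I Lemma 5.6, p. 26] [cite: DinaIonicaSijsling2022, §1.2 Prop. 10] -/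
theorem SiegelCMPoint.IsCMPointOf.isIsogenous_iff_cmTypeGaloisSetoid_r_of_isCyclic [IsGalois ℚ K]
    (hcyc : IsCyclic (K ≃ₐ[ℚ] K)) (hK : finrank ℚ K = 2 * g) (hZ : SiegelCMPoint.IsCMPointOf h Z)
    (hZ' : SiegelCMPoint.IsCMPointOf h' Z') (hS : IsSimple (prinPeriod Z')) :
    IsIsogenous (prinPeriod Z) (prinPeriod Z') ↔ (cmTypeGaloisSetoid K).r (hZ'.cmType hK) (hZ.cmType hK) :=
  hZ.isIsogenous_iff_cmTypeGaloisSetoid_r (fun a b => by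
    letI : CommGroup (K ≃ₐ[ℚ] K) := IsCyclic.commGroup
    exact mul_comm a b) hK hZ' hS

/-- `K/ℚ` abelian: isogenous simple CM points have types with the same reflex field `⊂ ℂ`.
[cite: Streng2010, Ch. I §4, p. 22 and Lemma 5.6, p. 26] [cite: Shimura1998, §8.3 Prop. 28] -/
theorem SiegelCMPoint.IsCMPointOf.traceField_cmType_eq_of_isIsogenous [IsGalois ℚ K]
    (hcomm : ∀ a b : K ≃ₐ[ℚ] K, a * b = b * a) (hK : finrank ℚ K = 2 * g) (hZ : SiegelCMPoint.IsCMPointOf h Z)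
    (hZ' : SiegelCMPoint.IsCMPointOf h' Z') (hS : IsSimple (prinPeriod Z'))
    (hiso : IsIsogenous (prinPeriod Z) (prinPeriod Z')) : traceField (hZ.cmType hK) = traceField (hZ'.cmType hK) :=
  traceField_eq_of_rel_of_comm hcomm ((hZ.isIsogenous_iff_cmTypeGaloisSetoid_r hcomm hK hZ' hS).1 hiso)

end Siegel

end Literature.NumberTheory.ComplexMultiplication
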